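import Summits.CriticalPhenomena.PercolationContinuityZ3.Theorems.PercNearOneGluingNoHeavyQuantLightTwoBlobFlow
import Summits.CriticalPhenomena.PercolationContinuityZ3.Theorems.PercNearOneGluingNoHeavyQuantLightLightTwoBlobCellsZ
import Summits.CriticalPhenomena.PercolationContinuityZ3.Theorems.PercNearOneGluingNoHeavyQuantLightLightTwoBlobCaseO
import HarnessLib

/-!
# QUANT lane R8, T-DEC: the LIGHT–LIGHT two-blob law — part 4: **`LawDec.LightLightTwoBlobDEC` (typed) HOLDS**

builds on p205010 (kernel theorem, internal audit signed; external expert review pending)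

Support file (`--supports stmt-CriticalPhenomena-4575`), QUANT lane typer seat prim-quant-stmt (gen 23), rung R8 of
`run/shared/lean/prim/quant/LADDER.md`.  One `Prop` definition (`LawDec.LightLightTwoBlobDEC`), theorems otherwise; standard axioms, no sorries.
* `lightLightTwoBlob_decAtT_bLowK` / `_bLow` — sub-case "b low" (`2b < c`): certificate (I\\*) via `LawDec.twoBlob_decAtT_of_lowFlow`
  (`…QuantLightTwoBlobFlow`) with the closed-form capacity of the mid `a`, top inequality by `top_Z_*` (`…QuantLightLightTwoBlobCellsZ`).
* `lightLightTwoBlob_decAtT_zero` — sub-case O, gate form (`…QuantLightLightTwoBlobCaseO`).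
* **`LawDec.LightLightTwoBlobDEC`** (the statement) and **`LawDec.lightLightTwoBlobDEC_holds`** — "a low" by exchanging the blobs (`law2_swap`).
STATE after this file: the two-blob law `LAW2` is DEC at the sum of the ARCH credits of its two blobs for EVERY pair of gates — heavy–heavy
(BLOB-DEC(2): `BlobDec2.decAt_all`, census-2 g51/g52), light–heavy (`LawDec.lightTwoBlobDEC_holds`, p300067), light–light (here).
OPEN (T-DEC): light straddlers of Conjecture SL (`LawDec.SliceClosed`), the gate/conv interaction, `LawDec.SDECConvClosed` / `TreeBuiltDEC`,
`Quant.TreeDEC`, `Quant.FarTreeRow`.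

[this work]; DEC rules ARCH-TREES-G49 §2.2 / DEC-TAMP-G50 §3.1, flow normal form `…QuantLawDecFlows` (this lane).  The gluing rows served
[cite: KozmaNitzan2024, Conjecture 3 (p. 15)]; product measure [cite: Grimmett1999, §1.3 p. 10].
-/

noncomputable section

namespace Summit.CriticalPhenomena.PercolationContinuityZ3.Theorems

namespace Quant

open Finset

/-- the two-blob law `(1−u)(1−v)δ₀ + u(1−v)δ_a + (1−u)vδ_b + uvδ_{a+b}` evaluated at `h` (as in `…QuantBlobDecTwoLawParts`) -/
local notation3 "LAW2[" a ", " u ", " b ", " v ", " h "]" =>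
  (1 - (u : ℝ)) * (1 - (v : ℝ)) * (if (h : ℕ) = 0 then (1 : ℝ) else 0)
    + (u : ℝ) * (1 - (v : ℝ)) * (if (h : ℕ) = (a : ℕ) then (1 : ℝ) else 0)
    + (1 - (u : ℝ)) * (v : ℝ) * (if (h : ℕ) = (b : ℕ) then (1 : ℝ) else 0)
    + (u : ℝ) * (v : ℝ) * (if (h : ℕ) = (a : ℕ) + (b : ℕ) then (1 : ℝ) else 0)

namespace LawDec

/-! ### Sub-case Z (`b` low), `κ`-form -/

/-- **light–light law, sub-case "b low"** (`2b < T`; `κ`-form): DEC at `T` by certificate (I\*) (`twoBlob_decAtT_of_lowFlow`: `b ↦ a+b`,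
`0 ↦ a` to capacity, rest `↦ a+b`) and the three cells `top_Z_*`. [this work] -/
theorem lightLightTwoBlob_decAtT_bLowK (x κ₁ κ₂ : ℝ) (a b j'' : ℕ) (hx0 : 0 < x) (hx1 : x < 1) (hk0 : 0 < κ₁) (hkx : κ₁ < x) (hk20 : 0 < κ₂) (hk2x : κ₂ < x)
    (ha : 1 ≤ a) (hb : 1 ≤ b) (hj : a + b ≤ j'')
    (h2b : 2 * (b : ℝ) < ((b : ℝ) * κ₁ + (a : ℝ) * κ₂)) :
    DECAtT x ((b : ℝ) * κ₁ + (a : ℝ) * κ₂) j'' (b + a) (fun h => LAW2[b, (x ^ 2 + (1 - x) * κ₁), a, (x ^ 2 + (1 - x) * κ₂), h]) := by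
  have ha0 : (0 : ℝ) < (a : ℝ) := by exact_mod_cast Nat.lt_of_lt_of_le Nat.zero_lt_one ha
  have hb0 : (0 : ℝ) < (b : ℝ) := by exact_mod_cast Nat.lt_of_lt_of_le Nat.zero_lt_one hb
  have hu0 : 0 ≤ x ^ 2 + (1 - x) * κ₁ := by nlinarith [mul_pos (sub_pos.2 hx1) hk0]
  have hu1 : x ^ 2 + (1 - x) * κ₁ ≤ 1 := by nlinarith [mul_lt_mul_of_pos_left hkx (sub_pos.2 hx1)]
  have hux : x ^ 2 + (1 - x) * κ₁ < x := by nlinarith [mul_lt_mul_of_pos_left hkx (sub_pos.2 hx1)]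
  have hv0 : 0 ≤ x ^ 2 + (1 - x) * κ₂ := by nlinarith [mul_pos (sub_pos.2 hx1) hk20]
  have hv1 : x ^ 2 + (1 - x) * κ₂ ≤ 1 := by nlinarith [mul_lt_mul_of_pos_left hk2x (sub_pos.2 hx1)]
  have hvx : x ^ 2 + (1 - x) * κ₂ < x := by nlinarith [mul_lt_mul_of_pos_left hk2x (sub_pos.2 hx1)]
  have hT0 : 0 < (b : ℝ) * κ₁ + (a : ℝ) * κ₂ := by nlinarith [mul_pos hb0 hk0, mul_pos ha0 hk20]
  have hsT : (b : ℝ) * κ₁ + (a : ℝ) * κ₂ < (b : ℝ) + (a : ℝ) := by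
    nlinarith [mul_pos hb0 (sub_pos.2 (hkx.trans hx1)), mul_pos ha0 (sub_pos.2 (hk2x.trans hx1))]
  have hbaj : b + a ≤ j'' := by omega
  have hba : b < a := by exact_mod_cast (by linarith : (b : ℝ) < a)
  have hm0 : 0 ≤ (1 - (x ^ 2 + (1 - x) * κ₁)) * (1 - (x ^ 2 + (1 - x) * κ₂)) := mul_nonneg (by linarith) (by linarith)
  rcases lt_or_ge ((b : ℝ) * κ₁ + (a : ℝ) * κ₂) (a : ℝ) with hTa | hTa
  · have haT : 0 < (a : ℝ) - ((b : ℝ) * κ₁ + (a : ℝ) * κ₂) := by linarith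
    rcases le_or_gt ((b : ℝ) * κ₁ + (a : ℝ) * κ₂) (x * (a : ℝ)) with hLa | hHa
    · -- (0,a) light
      have hFd : 0 < x ^ 2 * (a : ℝ) + (1 - x) * ((b : ℝ) * κ₁ + (a : ℝ) * κ₂) := by nlinarith [mul_pos (pow_pos hx0 2) ha0]
      have hFn : 0 < (1 - x) * ((1 + x) * (a : ℝ) - ((b : ℝ) * κ₁ + (a : ℝ) * κ₂)) := by
        apply mul_pos (sub_pos.2 hx1); nlinarith [mul_pos hx0 ha0]
      refine twoBlob_decAtT_of_lowFlow x (x ^ 2 + (1 - x) * κ₁) (x ^ 2 + (1 - x) * κ₂) ((b : ℝ) * κ₁ + (a : ℝ) * κ₂) (((1 - (x ^ 2 + (1 - x) * κ₁)) * (x ^ 2 + (1 - x) * κ₂)) * ((1 - x) * ((1 + x) * (a : ℝ) - ((b : ℝ) * κ₁ + (a : ℝ) * κ₂))) / (x ^ 2 * (a : ℝ) + (1 - x) * ((b : ℝ) * κ₁ + (a : ℝ) * κ₂))) b a j'' hx0 hx1 hu0 hu1 hv0 hv1 hb hba hbaj h2b hsT ?_ ?_ ?_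
        (top_Z_L x κ₁ κ₂ a b j'' hx0 hx1 hk0 hkx hk20 hk2x ha hb hj h2b hTa hLa)
      · exact div_nonneg (mul_nonneg (mul_nonneg (sub_nonneg.2 hu1) hv0) hFn.le) hFd.le
      · rw [div_le_iff₀ hFd]
        nlinarith [mul_nonneg (sub_nonneg.2 hu1) (mul_nonneg (sub_nonneg.2 hx1.le) (mul_nonneg hb0.le hk0.le))]
      · intro _
        refine ⟨hTa, le_of_eq ?_⟩
        rw [usage0_eq_light x _ j'' a hx0 hx1 (by omega) hT0 hTa hLa, div_mul_div_comm, div_eq_iff (mul_ne_zero hFn.ne' hFd.ne')]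
        ring
    · -- (0,a) heavy
      refine twoBlob_decAtT_of_lowFlow x (x ^ 2 + (1 - x) * κ₁) (x ^ 2 + (1 - x) * κ₂) ((b : ℝ) * κ₁ + (a : ℝ) * κ₂) (((1 - (x ^ 2 + (1 - x) * κ₁)) * (x ^ 2 + (1 - x) * κ₂)) * ((a : ℝ) - ((b : ℝ) * κ₁ + (a : ℝ) * κ₂)) / ((b : ℝ) * κ₁ + (a : ℝ) * κ₂)) b a j'' hx0 hx1 hu0 hu1 hv0 hv1 hb hba hbaj h2b hsT ?_ ?_ ?_
        (top_Z_H x κ₁ κ₂ a b j'' hx0 hx1 hk0 hkx hk20 hk2x ha hb hj h2b hTa hHa.le)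
      · exact div_nonneg (mul_nonneg (mul_nonneg (sub_nonneg.2 hu1) hv0) haT.le) hT0.le
      · rw [div_le_iff₀ hT0]
        nlinarith [mul_nonneg (sub_nonneg.2 hu1) (sub_nonneg.2 hHa.le), mul_lt_mul_of_pos_right hvx ha0]
      · intro _
        refine ⟨hTa, le_of_eq ?_⟩
        rw [usage0_eq_heavy x _ j'' a hx0 hx1 (by omega) hT0 hTa hHa.le, div_mul_div_comm, div_eq_iff (mul_ne_zero haT.ne' hT0.ne')]
        ring
  · -- a ≤ T: atom 0 uses the top only
    exact twoBlob_decAtT_of_lowFlow x (x ^ 2 + (1 - x) * κ₁) (x ^ 2 + (1 - x) * κ₂) ((b : ℝ) * κ₁ + (a : ℝ) * κ₂) 0 b a j'' hx0 hx1 hu0 hu1 hv0 hv1 hb hba hbaj h2b hsT le_rfl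
      (by linarith [hm0]) (fun h => absurd h (lt_irrefl 0))
      (top_Z_inc x κ₁ κ₂ a b j'' hx0 hx1 hk0 hkx hk20 hk2x ha hb hj h2b hTa)


/-! ### The light–light two-blob law: statement and proof -/

/-- **THE LIGHT–LIGHT TWO-BLOB LAW IS DEC AT THE SUM OF ITS CREDITS**: for a floor `0 < x < 1`, two LIGHT gates `x² < γ₁, γ₂ < x`,
sizes `a, b ≥ 1` and every layer `j″ ≥ a + b` (no giants), the law of `b·Bern(γ₁) + a·Bern(γ₂)` (atoms `0, b, a, a+b`, masses
`(1−γ₁)(1−γ₂), γ₁(1−γ₂), (1−γ₁)γ₂, γ₁γ₂`) is DEC(j″) at the target `b·κ_x(γ₁) + a·κ_x(γ₂)`, `κ_x(γ) = (γ − x²)/(1 − x)`.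
Companion of `LawDec.LightTwoBlobDEC` (light–heavy, `…QuantLightTwoBlobDEC`, typer g22/g23) and BLOB-DEC(2) (heavy–heavy, census-2
g51/g52, `…QuantBlobDecTwoCerts/Alg`): with it the two-blob law is DEC at the sum of the ARCH credits for EVERY pair of gates — lead g21's
"SL-light" for pair components (LEAD-NOTES-G21 N45 (6)(b)), the piece conv-closure of DEC needs beyond the heavy world.  EVIDENCE before
the proof (exact LP): 94 688 adversarial instances / 0 failures.  Proved below (`lightLightTwoBlobDEC_holds`).  builds on p205010 (kernel
theorem, internal audit signed; external expert review pending). [this work] -/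
def LightLightTwoBlobDEC : Prop :=
  ∀ (x γ₁ γ₂ : ℝ) (a b j'' : ℕ), 0 < x → x < 1 → x ^ 2 < γ₁ → γ₁ < x → x ^ 2 < γ₂ → γ₂ < x → 1 ≤ a → 1 ≤ b → a + b ≤ j'' →
    DECAtT x ((b : ℝ) * ((γ₁ - x ^ 2) / (1 - x)) + (a : ℝ) * ((γ₂ - x ^ 2) / (1 - x))) j'' (b + a) (fun h => LAW2[b, γ₁, a, γ₂, h])

/-- **light–light law, sub-case "b low"** (`2b < c`), gate form. [this work] -/
theorem lightLightTwoBlob_decAtT_bLow (x γ₁ γ₂ : ℝ) (a b j'' : ℕ) (hx0 : 0 < x) (hx1 : x < 1)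
    (hγ₁0 : x ^ 2 < γ₁) (hγ₁x : γ₁ < x) (hγ₂0 : x ^ 2 < γ₂) (hγ₂x : γ₂ < x) (ha : 1 ≤ a) (hb : 1 ≤ b) (hj : a + b ≤ j'')
    (h2b : 2 * (b : ℝ) < ((b : ℝ) * ((γ₁ - x ^ 2) / (1 - x)) + (a : ℝ) * ((γ₂ - x ^ 2) / (1 - x)))) :
    DECAtT x ((b : ℝ) * ((γ₁ - x ^ 2) / (1 - x)) + (a : ℝ) * ((γ₂ - x ^ 2) / (1 - x))) j'' (b + a) (fun h => LAW2[b, γ₁, a, γ₂, h]) := by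
  have h1x : (1 : ℝ) - x ≠ 0 := by linarith
  obtain ⟨κ₁, hγ₁⟩ : ∃ κ₁ : ℝ, γ₁ = x ^ 2 + (1 - x) * κ₁ := ⟨(γ₁ - x ^ 2) / (1 - x), by field_simp; ring⟩
  obtain ⟨κ₂, hγ₂⟩ : ∃ κ₂ : ℝ, γ₂ = x ^ 2 + (1 - x) * κ₂ := ⟨(γ₂ - x ^ 2) / (1 - x), by field_simp; ring⟩
  subst hγ₁; subst hγ₂
  have e1 : (x ^ 2 + (1 - x) * κ₁ - x ^ 2) / (1 - x) = κ₁ := by field_simp; ring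
  have e2 : (x ^ 2 + (1 - x) * κ₂ - x ^ 2) / (1 - x) = κ₂ := by field_simp; ring
  rw [e1, e2] at h2b ⊢
  have hk0 : 0 < κ₁ := pos_of_mul_pos_right (by linarith : 0 < (1 - x) * κ₁) (by linarith)
  have hkx : κ₁ < x := lt_of_mul_lt_mul_left (by nlinarith : (1 - x) * κ₁ < (1 - x) * x) (by linarith)
  have hk20 : 0 < κ₂ := pos_of_mul_pos_right (by linarith : 0 < (1 - x) * κ₂) (by linarith)
  have hk2x : κ₂ < x := lt_of_mul_lt_mul_left (by nlinarith : (1 - x) * κ₂ < (1 - x) * x) (by linarith)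
  exact lightLightTwoBlob_decAtT_bLowK x κ₁ κ₂ a b j'' hx0 hx1 hk0 hkx hk20 hk2x ha hb hj h2b

/-- **light–light law, sub-case O** (`c ≤ 2b`, `c ≤ 2a`), gate form. [this work] -/
theorem lightLightTwoBlob_decAtT_zero (x γ₁ γ₂ : ℝ) (a b j'' : ℕ) (hx0 : 0 < x) (hx1 : x < 1)
    (hγ₁0 : x ^ 2 < γ₁) (hγ₁x : γ₁ < x) (hγ₂0 : x ^ 2 < γ₂) (hγ₂x : γ₂ < x) (ha : 1 ≤ a) (hb : 1 ≤ b) (hj : a + b ≤ j'')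
    (h2b : ((b : ℝ) * ((γ₁ - x ^ 2) / (1 - x)) + (a : ℝ) * ((γ₂ - x ^ 2) / (1 - x))) ≤ 2 * (b : ℝ)) (h2a : ((b : ℝ) * ((γ₁ - x ^ 2) / (1 - x)) + (a : ℝ) * ((γ₂ - x ^ 2) / (1 - x))) ≤ 2 * (a : ℝ)) :
    DECAtT x ((b : ℝ) * ((γ₁ - x ^ 2) / (1 - x)) + (a : ℝ) * ((γ₂ - x ^ 2) / (1 - x))) j'' (b + a) (fun h => LAW2[b, γ₁, a, γ₂, h]) := by
  have h1x : (1 : ℝ) - x ≠ 0 := by linarith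
  obtain ⟨κ₁, hγ₁⟩ : ∃ κ₁ : ℝ, γ₁ = x ^ 2 + (1 - x) * κ₁ := ⟨(γ₁ - x ^ 2) / (1 - x), by field_simp; ring⟩
  obtain ⟨κ₂, hγ₂⟩ : ∃ κ₂ : ℝ, γ₂ = x ^ 2 + (1 - x) * κ₂ := ⟨(γ₂ - x ^ 2) / (1 - x), by field_simp; ring⟩
  subst hγ₁; subst hγ₂
  have e1 : (x ^ 2 + (1 - x) * κ₁ - x ^ 2) / (1 - x) = κ₁ := by field_simp; ring
  have e2 : (x ^ 2 + (1 - x) * κ₂ - x ^ 2) / (1 - x) = κ₂ := by field_simp; ring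
  rw [e1, e2] at h2b h2a ⊢
  have hk0 : 0 < κ₁ := pos_of_mul_pos_right (by linarith : 0 < (1 - x) * κ₁) (by linarith)
  have hkx : κ₁ < x := lt_of_mul_lt_mul_left (by nlinarith : (1 - x) * κ₁ < (1 - x) * x) (by linarith)
  have hk20 : 0 < κ₂ := pos_of_mul_pos_right (by linarith : 0 < (1 - x) * κ₂) (by linarith)
  have hk2x : κ₂ < x := lt_of_mul_lt_mul_left (by nlinarith : (1 - x) * κ₂ < (1 - x) * x) (by linarith)
  exact lightLightTwoBlob_decAtT_zeroK x κ₁ κ₂ a b j'' hx0 hx1 hk0 hkx hk20 hk2x ha hb hj h2b h2a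

/-- **`LightLightTwoBlobDEC` HOLDS.**  Sub-case "b low" directly, "a low" by exchanging the blobs (`law2_swap`), otherwise sub-case O.
[this work] -/
theorem lightLightTwoBlobDEC_holds : LightLightTwoBlobDEC := by
  intro x γ₁ γ₂ a b j'' hx0 hx1 hγ₁0 hγ₁x hγ₂0 hγ₂x ha hb hj
  by_cases h2b : 2 * (b : ℝ) < (b : ℝ) * ((γ₁ - x ^ 2) / (1 - x)) + (a : ℝ) * ((γ₂ - x ^ 2) / (1 - x))
  · exact lightLightTwoBlob_decAtT_bLow x γ₁ γ₂ a b j'' hx0 hx1 hγ₁0 hγ₁x hγ₂0 hγ₂x ha hb hj h2b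
  · by_cases h2a : 2 * (a : ℝ) < (b : ℝ) * ((γ₁ - x ^ 2) / (1 - x)) + (a : ℝ) * ((γ₂ - x ^ 2) / (1 - x))
    · have key := lightLightTwoBlob_decAtT_bLow x γ₂ γ₁ b a j'' hx0 hx1 hγ₂0 hγ₂x hγ₁0 hγ₁x hb ha (by omega) (by linarith)
      rw [law2_swap b a γ₂ γ₁, Nat.add_comm a b, add_comm ((a : ℝ) * _)] at key
      exact key
    · exact lightLightTwoBlob_decAtT_zero x γ₁ γ₂ a b j'' hx0 hx1 hγ₁0 hγ₁x hγ₂0 hγ₂x ha hb hj (not_lt.1 h2b) (not_lt.1 h2a)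

end LawDec

end Quant

end Summit.CriticalPhenomena.PercolationContinuityZ3.Theorems
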